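import Mathlib
import Summits.KontsevichZagierPeriods.KontsevichZagierPeriods.Theorems.SoloInformedKummerZetaKernel
import HarnessLib
import HarnessLib.Audit

/-!
# Kummer family VI: the order-four torsion law for the third kind, I — the Pell–Abel unit (s41)

COROLLARY XXIX.6 of the residency paper (§6quindecies): along the rational curve
`s ↦ (m(s), n(s))`, `1 < s < 1 + √2`,

  `m(s) = 1 − ((s²−1)/(2s))⁴`,   `n(s) = (s²+1)(1+2s−s²)/(4s³)`,

of HYPERBOLIC order-four torsion fibres of the Kummer family (`n = m·sn²(K/4 | m)`), the complete
elliptic integral of the third kind is an ALGEBRAIC multiple of the first kind INSIDE the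
Kontsevich–Zagier calculus:

  `⟦Π(n(s) | m(s))⟧ = ⟦[pt, α(s)]⟧ · ⟦K(m(s))⟧`,  `α(s) = (s²+2s−1)(3s²+2s+1)/(4(s−1)(s+1)³)`

(e.g. `s = 2`: `108·Π(5/32 | 175/256) = 119·K(175/256)`).  The mechanism is Abel's: the curve
carries the Pell–Abel unit `h = (A + B w)/(A − B w)`, `w = √((1−t²)(1−mt²))`,

  `A = (1 + b₂t²)(1 − mt²)`,  `B = t(g₁ + g₃t²)`,  `A² − B²(1−t²)(1−mt²) = (1−mt²)(1−nt²)⁴`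

(`soloInformed_t4_norm`), whose logarithmic differential is `dh/h = q(t)·κ(t)dt/(1−nt²)` with `q`
an even quadratic polynomial (`soloInformed_t4_numerator`:
`2(AB′−A′B)(1−t²)(1−mt²) + AB·((1−t²)(1−mt²))′ = q(1−mt²)(1−nt²)³`), and
`1 = α(1−nt²) + βq` (`soloInformed_t4_split`), so that `Π = αK + β∫₀¹ qκ/(1−nt²)` and the last
integral is `∫ d log h = 0` — realised in files II–IV by two Newton–Leibniz moves of one algebraic
2-form on `(0,1)²`, with no substitution.  This file: the parameters, the three polynomial
identities, positivity on the parameter range, the function `W = (1−t²)(1−mt²)κ = √(1−t²)√(1−mt²)`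
and the positivity and size of the denominators `A + v·BW`, `|v| ≤ 1`.

References: N. H. Abel, *Über die Integration der Differential-Formel ρdx/√R …*, J. reine angew.
Math. 1 (1826); M. Kontsevich, D. Zagier, *Periods* (2001), §1.2; this work (solo-informed s40–s41).
-/

noncomputable section

open MeasureTheory Set Filter
open scoped Classical

namespace Summit.KontsevichZagierPeriods.KontsevichZagierPeriods.Theorems

/-! ### The parameters of the order-four torsion curve -/

/-- The squared modulus `m(s) = 1 − ((s²−1)/(2s))⁴`. [this work] -/
def soloInformedT4m (s : ℝ) : ℝ := 1 - ((s ^ 2 - 1) / (2 * s)) ^ 4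

/-- The characteristic `n(s) = (s²+1)(1+2s−s²)/(4s³)` (`= m·sn²(K/4|m)`). [this work] -/
def soloInformedT4n (s : ℝ) : ℝ := (s ^ 2 + 1) * (1 + 2 * s - s ^ 2) / (4 * s ^ 3)

/-- `b₂(s)`, the coefficient of `A = (1 + b₂t²)(1 − mt²)`. [this work] -/
def soloInformedT4b (s : ℝ) : ℝ := (1 + 2 * s - s ^ 2) * (3 * s ^ 2 + 2 * s + 1) / (4 * s ^ 4)

/-- `g₁(s)`, the linear coefficient of `B = t(g₁ + g₃t²)`. [this work] -/
def soloInformedT4g (s : ℝ) : ℝ := (1 + 2 * s - s ^ 2) * (s ^ 2 + 2 * s + 3) / (4 * s ^ 2)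

/-- `g₃(s)`, the cubic coefficient of `B = t(g₁ + g₃t²)`. [this work] -/
def soloInformedT4h (s : ℝ) : ℝ := (s ^ 2 + 1) ^ 2 * (1 + 2 * s - s ^ 2) ^ 2 / (16 * s ^ 6)

/-- `A(s,t) = (1 + b₂t²)(1 − mt²)`. [this work] -/
def soloInformedT4A (s t : ℝ) : ℝ :=
  (1 + soloInformedT4b s * t ^ 2) * (1 - soloInformedT4m s * t ^ 2)

/-- `B(s,t) = t(g₁ + g₃t²)`. [this work] -/
def soloInformedT4B (s t : ℝ) : ℝ := t * (soloInformedT4g s + soloInformedT4h s * t ^ 2)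

/-- The even quadratic `q(s,t)` of `dh/h = qκ dt/(1−nt²)`. [this work] -/
def soloInformedT4q (s t : ℝ) : ℝ :=
  (1 + 2 * s - s ^ 2) * (4 * s ^ 3 * (s ^ 2 + 2 * s + 3) -
    (s ^ 2 + 1) * (s ^ 2 + 2 * s - 1) * (3 * s ^ 2 + 2 * s + 1) * t ^ 2) / (8 * s ^ 5)

/-- A bound `q₀(s) ≥ |q(s,t)|` on `t² ≤ 1`. [this work] -/
def soloInformedT4q0 (s : ℝ) : ℝ :=
  (1 + 2 * s - s ^ 2) * (4 * s ^ 3 * (s ^ 2 + 2 * s + 3) +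
    (s ^ 2 + 1) * (s ^ 2 + 2 * s - 1) * (3 * s ^ 2 + 2 * s + 1)) / (8 * s ^ 5)

/-- The numerator `N = q(1−mt²)(1−nt²)³` of the 2-form. [this work] -/
def soloInformedT4N (s t : ℝ) : ℝ :=
  soloInformedT4q s t * (1 - soloInformedT4m s * t ^ 2) * (1 - soloInformedT4n s * t ^ 2) ^ 3

/-- The algebraic ratio `α(s) = Π/K = (s²+2s−1)(3s²+2s+1)/(4(s−1)(s+1)³)`. [this work] -/
def soloInformedT4alpha (s : ℝ) : ℝ :=
  (s ^ 2 + 2 * s - 1) * (3 * s ^ 2 + 2 * s + 1) / (4 * ((s - 1) * (s + 1) ^ 3))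

/-- `β(s) = −s²/(2(s−1)(s+1)³)`, the coefficient of `∫ d log h`. [this work] -/
def soloInformedT4beta (s : ℝ) : ℝ := -s ^ 2 / (2 * ((s - 1) * (s + 1) ^ 3))

/-- `W(m,t) = (1−t²)(1−mt²)·κ(t)` (`= √(1−t²)√(1−mt²)`, `soloInformed_t4_W_eq_sqrt`). [this work] -/
def soloInformedT4W (m t : ℝ) : ℝ :=
  (1 - t ^ 2) * (1 - m * t ^ 2) * ((√(1 - t ^ 2))⁻¹ * (√(1 - m * t ^ 2))⁻¹)

/-! ### The three polynomial identities -/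

/-- **Pell–Abel norm identity** `A² − B²(1−t²)(1−mt²) = (1−mt²)(1−nt²)⁴`. [this work] -/
theorem soloInformed_t4_norm {s : ℝ} (hs : s ≠ 0) (t : ℝ) :
    soloInformedT4A s t ^ 2 - soloInformedT4B s t ^ 2 * ((1 - t ^ 2) * (1 - soloInformedT4m s * t ^ 2)) =
      (1 - soloInformedT4m s * t ^ 2) * (1 - soloInformedT4n s * t ^ 2) ^ 4 := by
  unfold soloInformedT4A soloInformedT4B soloInformedT4m soloInformedT4n soloInformedT4b
    soloInformedT4g soloInformedT4h
  field_simp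
  ring

/-- **The logarithmic derivative of the unit**: `2(AB′ − A′B)Δ + ABΔ′ = q(1−mt²)(1−nt²)³ = N`,
`Δ = (1−t²)(1−mt²)`, with `A′, B′, Δ′` written as the product rule delivers them. [this work] -/
theorem soloInformed_t4_numerator {s : ℝ} (hs : s ≠ 0) (t : ℝ) :
    2 * (soloInformedT4A s t * (1 * (soloInformedT4g s + soloInformedT4h s * t ^ 2) +
        t * (soloInformedT4h s * (2 * t))) -
      (soloInformedT4b s * (2 * t) * (1 - soloInformedT4m s * t ^ 2) +
        (1 + soloInformedT4b s * t ^ 2) * (-(soloInformedT4m s * (2 * t)))) * soloInformedT4B s t) *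
        ((1 - t ^ 2) * (1 - soloInformedT4m s * t ^ 2)) +
      soloInformedT4A s t * soloInformedT4B s t *
        (-(2 * t) * (1 - soloInformedT4m s * t ^ 2) + (1 - t ^ 2) * (-(soloInformedT4m s * (2 * t)))) =
      soloInformedT4N s t := by
  unfold soloInformedT4N soloInformedT4A soloInformedT4B soloInformedT4m soloInformedT4n soloInformedT4b
    soloInformedT4g soloInformedT4h soloInformedT4q
  field_simp
  ring

/-- **The splitting** `α(1−nt²) + βq = 1`. [this work] -/
theorem soloInformed_t4_split {s : ℝ} (hs : s ≠ 0) (h1 : s - 1 ≠ 0) (h2 : s + 1 ≠ 0) (t : ℝ) :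
    soloInformedT4alpha s * (1 - soloInformedT4n s * t ^ 2) + soloInformedT4beta s * soloInformedT4q s t =
      1 := by
  unfold soloInformedT4alpha soloInformedT4beta soloInformedT4n soloInformedT4q
  have h3 : (s - 1) * (s + 1) ^ 3 ≠ 0 := mul_ne_zero h1 (pow_ne_zero 3 h2)
  field_simp
  ring

/-! ### Positivity on the parameter range `1 < s`, `s² < 2s + 1` -/

/-- `0 < m(s) < 1`. [this work] -/
theorem soloInformed_t4_m_mem {s : ℝ} (hs : 1 < s) (hs' : s ^ 2 < 2 * s + 1) :
    soloInformedT4m s ∈ Ioo (0:ℝ) 1 := by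
  have hs0 : 0 < s := by linarith
  have hu0 : 0 < (s ^ 2 - 1) / (2 * s) := div_pos (by nlinarith) (by linarith)
  have hu1 : (s ^ 2 - 1) / (2 * s) < 1 := by rw [div_lt_one (by linarith)]; linarith
  have h4 : ((s ^ 2 - 1) / (2 * s)) ^ 4 < 1 := pow_lt_one₀ hu0.le hu1 (by norm_num)
  have h4' : 0 < ((s ^ 2 - 1) / (2 * s)) ^ 4 := pow_pos hu0 4
  unfold soloInformedT4m
  exact ⟨by linarith, by linarith⟩

/-- `0 < n(s) < 1` (`1 − n·1² > 0` because `4s³ − (s²+1)(1+2s−s²) = (s−1)(s+1)³`). [this work] -/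
theorem soloInformed_t4_n_mem {s : ℝ} (hs : 1 < s) (hs' : s ^ 2 < 2 * s + 1) :
    soloInformedT4n s ∈ Ioo (0:ℝ) 1 := by
  have hs0 : 0 < s := by linarith
  have hd : 0 < 4 * s ^ 3 := by positivity
  have hw : 0 < 1 + 2 * s - s ^ 2 := by linarith
  unfold soloInformedT4n
  refine ⟨div_pos (mul_pos (by positivity) hw) hd, ?_⟩
  rw [div_lt_one hd]
  have h : 0 < (s - 1) * (s + 1) ^ 3 := mul_pos (by linarith) (by positivity)
  nlinarith [h]

/-- `0 < b₂`, `0 < g₁`, `0 < g₃`. [this work] -/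
theorem soloInformed_t4_coeff_pos {s : ℝ} (hs : 1 < s) (hs' : s ^ 2 < 2 * s + 1) :
    0 < soloInformedT4b s ∧ 0 < soloInformedT4g s ∧ 0 < soloInformedT4h s := by
  have hs0 : 0 < s := by linarith
  have hw : 0 < 1 + 2 * s - s ^ 2 := by linarith
  unfold soloInformedT4b soloInformedT4g soloInformedT4h
  exact ⟨div_pos (mul_pos hw (by positivity)) (by positivity),
    div_pos (mul_pos hw (by positivity)) (by positivity), by positivity⟩

/-- `|q(s,t)| ≤ q₀(s)` for `t² ≤ 1`. [this work] -/
theorem soloInformed_t4_abs_q_le {s t : ℝ} (hs : 1 < s) (hs' : s ^ 2 < 2 * s + 1) (ht : t ^ 2 ≤ 1) :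
    |soloInformedT4q s t| ≤ soloInformedT4q0 s := by
  have hs0 : 0 < s := by linarith
  have hw : 0 < 1 + 2 * s - s ^ 2 := by linarith
  have hd : 0 < 8 * s ^ 5 := by positivity
  have hP : 0 ≤ 4 * s ^ 3 * (s ^ 2 + 2 * s + 3) := by positivity
  have hQ : 0 ≤ (s ^ 2 + 1) * (s ^ 2 + 2 * s - 1) * (3 * s ^ 2 + 2 * s + 1) :=
    mul_nonneg (mul_nonneg (by positivity) (by nlinarith)) (by positivity)
  unfold soloInformedT4q soloInformedT4q0
  rw [abs_div, abs_of_pos hd, div_le_div_iff_of_pos_right hd, abs_mul, abs_of_pos hw]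
  refine mul_le_mul_of_nonneg_left (abs_le.2 ⟨?_, ?_⟩) hw.le
  · nlinarith [mul_le_mul_of_nonneg_left ht hQ, sq_nonneg t]
  · nlinarith [mul_nonneg hQ (sq_nonneg t)]

/-- `0 < A(s,t)` for `t² ≤ 1`, and `A ≤ 1 + b₂`. [this work] -/
theorem soloInformed_t4_A_pos {s t : ℝ} (hs : 1 < s) (hs' : s ^ 2 < 2 * s + 1) (ht : t ^ 2 ≤ 1) :
    0 < soloInformedT4A s t ∧ soloInformedT4A s t ≤ 1 + soloInformedT4b s := by
  have hm := soloInformed_t4_m_mem hs hs'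
  have hb := (soloInformed_t4_coeff_pos hs hs').1
  have h1 : 1 ≤ 1 + soloInformedT4b s * t ^ 2 := by nlinarith [sq_nonneg t]
  have h2 : 1 + soloInformedT4b s * t ^ 2 ≤ 1 + soloInformedT4b s := by nlinarith
  have h3 : 0 < 1 - soloInformedT4m s * t ^ 2 := by nlinarith [hm.1, hm.2]
  have h4 : 1 - soloInformedT4m s * t ^ 2 ≤ 1 := by nlinarith [hm.1, sq_nonneg t]
  unfold soloInformedT4A
  exact ⟨mul_pos (by linarith) h3, by nlinarith [mul_le_mul h2 h4 h3.le (by linarith)]⟩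

/-- `0 ≤ B(s,t) ≤ g₁ + g₃` for `0 ≤ t ≤ 1`. [this work] -/
theorem soloInformed_t4_B_mem {s t : ℝ} (hs : 1 < s) (hs' : s ^ 2 < 2 * s + 1) (ht : t ∈ Icc (0:ℝ) 1) :
    0 ≤ soloInformedT4B s t ∧ soloInformedT4B s t ≤ soloInformedT4g s + soloInformedT4h s := by
  obtain ⟨-, hg, hh⟩ := soloInformed_t4_coeff_pos hs hs'
  have ht2 : t ^ 2 ≤ 1 := by nlinarith [ht.1, ht.2]
  have h1 : 0 ≤ soloInformedT4g s + soloInformedT4h s * t ^ 2 := by positivity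
  have h2 : soloInformedT4g s + soloInformedT4h s * t ^ 2 ≤ soloInformedT4g s + soloInformedT4h s := by
    nlinarith
  unfold soloInformedT4B
  exact ⟨mul_nonneg ht.1 h1, by nlinarith [mul_le_mul ht.2 h2 h1 zero_le_one]⟩

/-! ### The function `W = Δκ = √Δ` -/

/-- `W(m,t) = √(1−t²)·√(1−mt²)` (`x/√x = √x`, junk values included). [folklore] -/
theorem soloInformed_t4_W_eq_sqrt (m t : ℝ) : soloInformedT4W m t = √(1 - t ^ 2) * √(1 - m * t ^ 2) := by
  have h1 : (1 - t ^ 2) * (√(1 - t ^ 2))⁻¹ = √(1 - t ^ 2) := by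
    rw [← div_eq_mul_inv, Real.div_sqrt]
  have h2 : (1 - m * t ^ 2) * (√(1 - m * t ^ 2))⁻¹ = √(1 - m * t ^ 2) := by
    rw [← div_eq_mul_inv, Real.div_sqrt]
  unfold soloInformedT4W
  calc (1 - t ^ 2) * (1 - m * t ^ 2) * ((√(1 - t ^ 2))⁻¹ * (√(1 - m * t ^ 2))⁻¹)
      = ((1 - t ^ 2) * (√(1 - t ^ 2))⁻¹) * ((1 - m * t ^ 2) * (√(1 - m * t ^ 2))⁻¹) := by ring
    _ = √(1 - t ^ 2) * √(1 - m * t ^ 2) := by rw [h1, h2]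

/-- `0 ≤ W`. [folklore] -/
theorem soloInformed_t4_W_nonneg (m t : ℝ) : 0 ≤ soloInformedT4W m t := by
  rw [soloInformed_t4_W_eq_sqrt]; positivity

/-- `W² = (1−t²)(1−mt²)` for `t² < 1`, `0 < m < 1`. [folklore] -/
theorem soloInformed_t4_W_sq {m t : ℝ} (hm : m ∈ Ioo (0:ℝ) 1) (ht : t ^ 2 < 1) :
    soloInformedT4W m t ^ 2 = (1 - t ^ 2) * (1 - m * t ^ 2) := by
  obtain ⟨h1, h2⟩ := soloInformed_kummerZeta_radicands_pos hm ht
  rw [soloInformed_t4_W_eq_sqrt, mul_pow, Real.sq_sqrt h1.le, Real.sq_sqrt h2.le]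

/-- `W ≤ 1` for `0 < m < 1`. [folklore] -/
theorem soloInformed_t4_W_le_one {m : ℝ} (hm : m ∈ Ioo (0:ℝ) 1) (t : ℝ) :
    soloInformedT4W m t ≤ 1 := by
  have hs1 : √(1 - t ^ 2) ≤ 1 := by
    rw [show (1:ℝ) = √1 from Real.sqrt_one.symm]
    exact Real.sqrt_le_sqrt (by rw [Real.sqrt_one]; nlinarith)
  have hs2 : √(1 - m * t ^ 2) ≤ 1 := by
    rw [show (1:ℝ) = √1 from Real.sqrt_one.symm]
    exact Real.sqrt_le_sqrt (by rw [Real.sqrt_one]; nlinarith [mul_nonneg hm.1.le (sq_nonneg t)])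
  rw [soloInformed_t4_W_eq_sqrt]
  calc √(1 - t ^ 2) * √(1 - m * t ^ 2) ≤ 1 * 1 :=
        mul_le_mul hs1 hs2 (Real.sqrt_nonneg _) zero_le_one
    _ = 1 := one_mul 1

/-- `W(m,1) = 0`. [folklore] -/
theorem soloInformed_t4_W_one (m : ℝ) : soloInformedT4W m 1 = 0 := by
  simp [soloInformedT4W]

/-- `∂_t W = −t((1−mt²) + m(1−t²))·κ` for `t² < 1`. [folklore] -/
theorem soloInformed_t4_W_hasDerivAt {m t : ℝ} (hm : m ∈ Ioo (0:ℝ) 1) (ht : t ^ 2 < 1) :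
    HasDerivAt (fun t => soloInformedT4W m t)
      (-(t * ((1 - m * t ^ 2) + m * (1 - t ^ 2))) * ((√(1 - t ^ 2))⁻¹ * (√(1 - m * t ^ 2))⁻¹)) t := by
  obtain ⟨h1, h2⟩ := soloInformed_kummerZeta_radicands_pos hm ht
  have hΔ : HasDerivAt (fun t : ℝ => (1 - t ^ 2) * (1 - m * t ^ 2))
      (-(2 * t) * (1 - m * t ^ 2) + (1 - t ^ 2) * (-(m * (2 * t)))) t :=
    ((soloInformed_hasDerivAt_sq t).const_sub 1).mul
      (((soloInformed_hasDerivAt_sq t).const_mul m).const_sub 1)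
  have hκ := soloInformed_kummerZeta_kappa_hasDerivAt hm ht
  have h1' : 1 - t ^ 2 ≠ 0 := h1.ne'
  have h2' : 1 - m * t ^ 2 ≠ 0 := h2.ne'
  have hr : (1 - t ^ 2) * (1 - m * t ^ 2) * (t / (1 - t ^ 2) + m * t / (1 - m * t ^ 2)) =
      t * (1 - m * t ^ 2) + m * t * (1 - t ^ 2) := by
    rw [div_add_div _ _ h1' h2', ← mul_div_assoc, mul_div_cancel_left₀ _ (mul_ne_zero h1' h2')]
    ring
  unfold soloInformedT4W
  refine (hΔ.mul hκ).congr_deriv ?_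
  linear_combination ((√(1 - t ^ 2))⁻¹ * (√(1 - m * t ^ 2))⁻¹) * hr

/-! ### The denominators `A + v·BW`, `|v| ≤ 1` -/

/-- `(BW)² < A²` for `t² < 1`: `(BW)² = B²Δ = A² − (1−mt²)(1−nt²)⁴`. [this work] -/
theorem soloInformed_t4_sq_BW_lt {s t : ℝ} (hs : 1 < s) (hs' : s ^ 2 < 2 * s + 1) (ht : t ^ 2 < 1) :
    (soloInformedT4B s t * soloInformedT4W (soloInformedT4m s) t) ^ 2 < soloInformedT4A s t ^ 2 := by
  have hm := soloInformed_t4_m_mem hs hs'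
  have hn := soloInformed_t4_n_mem hs hs'
  have hs0 : s ≠ 0 := by positivity
  have hW := soloInformed_t4_W_sq hm ht
  have hN := soloInformed_t4_norm hs0 t
  have h1 : 0 < 1 - soloInformedT4m s * t ^ 2 := by nlinarith [hm.1, hm.2]
  have h2 : 0 < 1 - soloInformedT4n s * t ^ 2 := by nlinarith [hn.1, hn.2]
  have h3 : 0 < (1 - soloInformedT4m s * t ^ 2) * (1 - soloInformedT4n s * t ^ 2) ^ 4 :=
    mul_pos h1 (pow_pos h2 4)
  rw [mul_pow, hW]
  linarith

/-- **The denominators are positive**: `0 < A + v·BW` for `t² < 1`, `|v| ≤ 1`. [this work] -/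
theorem soloInformed_t4_denom_pos {s t v : ℝ} (hs : 1 < s) (hs' : s ^ 2 < 2 * s + 1) (ht : t ^ 2 < 1)
    (hv : v ∈ Icc (-1:ℝ) 1) :
    0 < soloInformedT4A s t + v * (soloInformedT4B s t * soloInformedT4W (soloInformedT4m s) t) := by
  have hA := (soloInformed_t4_A_pos hs hs' ht.le).1
  have hX := abs_lt_of_sq_lt_sq' (soloInformed_t4_sq_BW_lt hs hs' ht) hA.le
  have h1 : |v * (soloInformedT4B s t * soloInformedT4W (soloInformedT4m s) t)| ≤
      |soloInformedT4B s t * soloInformedT4W (soloInformedT4m s) t| := by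
    rw [abs_mul]
    exact mul_le_of_le_one_left (abs_nonneg _) (abs_le.2 ⟨hv.1, hv.2⟩)
  have h2 : |soloInformedT4B s t * soloInformedT4W (soloInformedT4m s) t| < soloInformedT4A s t :=
    abs_lt.2 ⟨hX.1, hX.2⟩
  linarith [neg_abs_le (v * (soloInformedT4B s t * soloInformedT4W (soloInformedT4m s) t))]

/-- The uniform lower bound `d₀(s) = (1−m)(1−n)⁴/(1 + b₂ + (g₁ + g₃))` of the denominators.
[this work] -/
def soloInformedT4d0 (s : ℝ) : ℝ :=
  (1 - soloInformedT4m s) * (1 - soloInformedT4n s) ^ 4 /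
    (1 + soloInformedT4b s + (soloInformedT4g s + soloInformedT4h s))

/-- `0 < d₀(s)`. [this work] -/
theorem soloInformed_t4_d0_pos {s : ℝ} (hs : 1 < s) (hs' : s ^ 2 < 2 * s + 1) : 0 < soloInformedT4d0 s := by
  have hm := soloInformed_t4_m_mem hs hs'
  have hn := soloInformed_t4_n_mem hs hs'
  obtain ⟨hb, hg, hh⟩ := soloInformed_t4_coeff_pos hs hs'
  unfold soloInformedT4d0
  exact div_pos (mul_pos (by linarith [hm.2]) (pow_pos (by linarith [hn.2]) 4)) (by positivity)

/-- **Uniform lower bound**: `d₀ ≤ A + v·BW` for `0 ≤ t < 1`, `|v| ≤ 1`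
(`A − BW = (A² − B²Δ)/(A + BW) ≥ (1−m)(1−n)⁴/(1 + b₂ + g₁ + g₃)`). [this work] -/
theorem soloInformed_t4_denom_ge {s t v : ℝ} (hs : 1 < s) (hs' : s ^ 2 < 2 * s + 1) (ht : t ∈ Ico (0:ℝ) 1)
    (hv : v ∈ Icc (-1:ℝ) 1) :
    soloInformedT4d0 s ≤ soloInformedT4A s t + v * (soloInformedT4B s t * soloInformedT4W (soloInformedT4m s) t) := by
  have hm := soloInformed_t4_m_mem hs hs'
  have hn := soloInformed_t4_n_mem hs hs'
  have hs0 : s ≠ 0 := by positivity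
  have ht2 : t ^ 2 < 1 := by nlinarith [ht.1, ht.2]
  obtain ⟨hA, hAle⟩ := soloInformed_t4_A_pos hs hs' ht2.le
  obtain ⟨hB, hBle⟩ := soloInformed_t4_B_mem hs hs' ⟨ht.1, ht.2.le⟩
  obtain ⟨hb, hg, hh⟩ := soloInformed_t4_coeff_pos hs hs'
  have hW0 := soloInformed_t4_W_nonneg (soloInformedT4m s) t
  have hW1 := soloInformed_t4_W_le_one hm t
  have hWsq := soloInformed_t4_W_sq hm ht2
  have hN := soloInformed_t4_norm hs0 t
  set A := soloInformedT4A s t with hAdef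
  set B := soloInformedT4B s t with hBdef
  set W := soloInformedT4W (soloInformedT4m s) t with hWdef
  set M := 1 + soloInformedT4b s + (soloInformedT4g s + soloInformedT4h s) with hM
  have hM0 : 0 < M := by positivity
  have hBW : 0 ≤ B * W := mul_nonneg hB hW0
  have hBW1 : B * W ≤ soloInformedT4g s + soloInformedT4h s := by
    calc B * W ≤ (soloInformedT4g s + soloInformedT4h s) * 1 := mul_le_mul hBle hW1 hW0 (by positivity)
      _ = _ := mul_one _
  have hsum : A + B * W ≤ M := by linarith
  -- `(A − BW)(A + BW) = (1 − mt²)(1 − nt²)⁴ ≥ (1−m)(1−n)⁴`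
  have hprod : (A - B * W) * (A + B * W) =
      (1 - soloInformedT4m s * t ^ 2) * (1 - soloInformedT4n s * t ^ 2) ^ 4 := by
    rw [← hN]; ring_nf; rw [hWsq]; ring
  have h1m : 1 - soloInformedT4m s ≤ 1 - soloInformedT4m s * t ^ 2 := by nlinarith [hm.1]
  have h1n : 1 - soloInformedT4n s ≤ 1 - soloInformedT4n s * t ^ 2 := by nlinarith [hn.1]
  have h1m0 : 0 < 1 - soloInformedT4m s := by linarith [hm.2]
  have h1n0 : 0 < 1 - soloInformedT4n s := by linarith [hn.2]
  have hc : (1 - soloInformedT4m s) * (1 - soloInformedT4n s) ^ 4 ≤ (A - B * W) * (A + B * W) := by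
    rw [hprod]
    exact mul_le_mul h1m (pow_le_pow_left₀ h1n0.le h1n 4) (by positivity) (by linarith)
  have hpos : 0 < (A - B * W) * (A + B * W) := lt_of_lt_of_le (by positivity) hc
  have hApBW : 0 < A + B * W := by linarith
  have hAmBW : 0 < A - B * W := (mul_pos_iff_of_pos_right hApBW).1 hpos
  have hkey : soloInformedT4d0 s ≤ A - B * W := by
    unfold soloInformedT4d0
    rw [← hM, div_le_iff₀ hM0]
    calc (1 - soloInformedT4m s) * (1 - soloInformedT4n s) ^ 4 ≤ (A - B * W) * (A + B * W) := hc
      _ ≤ (A - B * W) * M := mul_le_mul_of_nonneg_left hsum hAmBW.le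
  have hvX : -(B * W) ≤ v * (B * W) := by nlinarith [hv.1]
  linarith

end Summit.KontsevichZagierPeriods.KontsevichZagierPeriods.Theorems

end
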